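import Summits.AtomisticToContinuum.Crystallization.Theorems.FrustratedLawDichotomyTransportPriceLocal

/-!
# FrustratedLawDichotomy · crux `AperiodicFrustratedLawGap` (stmt-AtomisticToContinuum-27623) — THE SURPLUS-SHARING PRICE
# (decomp-a2c, prover hand 2, structural share, generation 3)

The well-conditioned explicit form of the transport price.  Two covariant transports act at once — a PUSH `F₁` and a PULL `F₂`
(`lt_integral_rootEnergy_of_two_transports`: the Mecke identity for each, so the redistributed root energy
`rootEnergy + (in₁ − out₁) − (in₂ − out₂)` keeps the mean) — which is how a SIGNED redistribution is written with `ℝ≥0∞` masses.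
The canonical pair is SURPLUS SHARING AT RADIUS `r` (`sharing_transport` with the Giry-measurable surrogate of
`(rootEnergy − e⋆)^±`): every atom shares its surplus `rootEnergy − e⋆` over the periodic infimum `e⋆` — positive or negative — equally
among the atoms within distance `r` of it.  The root then holds exactly
`e⋆ + Σ_{atoms y ∈ B̄_r(0)} (rootEnergy(θ_y μ) − e⋆) / #{atoms of μ in B̄_r(y)}`, and the crux (route decl BY NAME), the registered stub
`S_aperiodicErgodicGap` (verbatim) and the `PeriodicChargeSplit` copy all follow from the

**SURPLUS-SHARING PRICE** (`aperiodicFrustratedLawGap_of_surplusSharingPrice`): for every hard core `δ > 0` and texture radii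
`R₇ R₈ R₉` there is a radius `r > 0` such that for EVERY rooted configuration `μ` which is `δ`- and `7/10`-hard-core, texture-charged
(`Appr μ R₇ R₈ R₉`), Nash at every atom, infinite and not a translate of a periodic point set, the `#B̄_r`-weighted local surplus around
the root is POSITIVE: `Σ_{atoms y ∈ B̄_r(0)} (rootEnergy(θ_y μ) − e⋆) / μ(B̄_r(y)) > 0` (stated as «negative part < positive part» of two
`lintegral`s).  No law, no expectation, no `e⋆`-independent constant: a dial in `r` which the census can evaluate site by site on every
candidate texture (TCP / Frank–Kasper / icosahedral-glass models: report `min_p Σ_{y ∈ B̄_r(p)} (h(y) − e_hcp)/n_r(y)` against `r`).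

All `[folklore]`.
-/

noncomputable section

namespace Summit.AtomisticToContinuum.Crystallization.Theorems.FrustratedLawDichotomyTransportPriceSurplus

open MeasureTheory Metric Set Filter
open scoped ENNReal Topology BigOperators
open Literature.MathematicalPhysics.StatisticalMechanics Literature.Probability.Process
open Summit.AtomisticToContinuum.Crystallization.Theorems.ChargedEnergyGapNegative (E3 eStar)
open Summit.AtomisticToContinuum.Crystallization.Theorems.FrustratedLawDichotomyFiniteClusterGap
  (ae_mem_of_sep measurable_ofReal_lennardJones_parts integrable_rootEnergy_of_ae_hardCore)
open Summit.AtomisticToContinuum.Crystallization.Theorems.FrustratedLawDichotomyTransportPrice (integral_inflow_toReal_eq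
  lintegral_outflow_ne_top_of_bound)
open Summit.AtomisticToContinuum.Crystallization.Theorems.FrustratedLawDichotomyTransportPriceLocal
  (rootEnergy_eq_parts rootEnergy_add_c0_nonneg rootEnergy_le_C0)
open Summit.AtomisticToContinuum.Crystallization.Theorems.FrustratedLawDichotomyHardCoreUpgrade (ae_isRootedHardCore_upgrade)
open Summit.AtomisticToContinuum.Crystallization.Theorems.FrustratedLawDichotomyAperiodicGapFiniteCut (ae_infinite_of_minimising_of_decl)
open Summit.AtomisticToContinuum.Crystallization.Theorems.FrustratedLawDichotomyErgodicReduction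
  (aperiodicFrustratedLawGap_iff_ergodicCase periodicChargeSplit_aperiodicFrustratedLawGap_iff_ergodicCase)
open Literature.Probability.Process.LocalConfig (finite_inter_of_separated)

/-! ## §1. Two transports (signed redistribution) -/

section TwoTransports

variable {δ : ℝ} {P : Measure (Measure E3)}

/-- On a probability space, an integrable function almost surely `> c` has integral `> c`. [folklore] -/
theorem lt_integral_of_ae_lt [IsProbabilityMeasure P] {g : Measure E3 → ℝ} (hI : Integrable g P) {c : ℝ}
    (hlt : ∀ᵐ μ ∂P, c < g μ) : c < ∫ μ, g μ ∂P := by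
  have hIc : Integrable (fun μ => g μ - c) P := hI.sub (integrable_const c)
  have hnn : 0 ≤ᵐ[P] fun μ => g μ - c := by
    filter_upwards [hlt] with μ hμ
    exact sub_nonneg.mpr hμ.le
  by_contra hle
  have hle' : ∫ μ, g μ ∂P ≤ c := not_lt.mp hle
  have hzero : ∫ μ, g μ - c ∂P = 0 := by
    refine le_antisymm ?_ (integral_nonneg_of_ae hnn)
    rw [integral_sub hI (integrable_const c), integral_const, smul_eq_mul, probReal_univ, one_mul]
    exact sub_nonpos.mpr hle'
  have hae : (fun μ => g μ - c) =ᵐ[P] 0 := (integral_eq_zero_iff_of_nonneg_ae hnn hIc).mp hzero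
  have hfalse : ∀ᵐ μ ∂P, False := by
    filter_upwards [hlt, hae] with μ hμ h0
    have h0' : g μ - c = 0 := h0
    have hpos : 0 < g μ - c := sub_pos.mpr hμ
    rw [h0'] at hpos
    exact lt_irrefl 0 hpos
  exact IsProbabilityMeasure.ne_zero P (ae_eq_bot.mp (Filter.eventually_false_iff_eq_bot.mp hfalse))

/-- **TWO TRANSPORTS (push and pull).**  Let `P` be a point-stationary probability law almost surely carried by rooted `δ`-hard-core
configurations and `F₁`, `F₂` jointly measurable covariant transports of finite mean out-flow.  If almost surely
`c < rootEnergy μ + (in₁ μ − out₁ μ) − (in₂ μ − out₂ μ)` then `c < E_P[rootEnergy]` (Mecke for each transport). [folklore] -/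
theorem lt_integral_rootEnergy_of_two_transports (hδ : 0 < δ) [IsProbabilityMeasure P] (hcore : ∀ᵐ μ ∂P, IsRootedHardCore δ μ)
    (hstat : IsPointStationaryLaw P) {F₁ F₂ : Measure E3 → E3 → ℝ≥0∞} (hF₁ : Measurable (Function.uncurry F₁))
    (hF₂ : Measurable (Function.uncurry F₂)) (hout₁ : ∫⁻ μ, ∫⁻ y, F₁ μ y ∂μ ∂P ≠ ∞) (hout₂ : ∫⁻ μ, ∫⁻ y, F₂ μ y ∂μ ∂P ≠ ∞)
    {c : ℝ}
    (hprice : ∀ᵐ μ ∂P, c < rootEnergy lennardJones μ +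
      ((∫⁻ y, F₁ (μ.map fun z => z - y) (-y) ∂μ).toReal - (∫⁻ y, F₁ μ y ∂μ).toReal) -
      ((∫⁻ y, F₂ (μ.map fun z => z - y) (-y) ∂μ).toReal - (∫⁻ y, F₂ μ y ∂μ).toReal)) :
    c < ∫ μ, rootEnergy lennardJones μ ∂P := by
  obtain ⟨-, -, hIo₁, hIi₁, heq₁⟩ := integral_inflow_toReal_eq hδ hcore hstat hF₁ hout₁
  obtain ⟨-, -, hIo₂, hIi₂, heq₂⟩ := integral_inflow_toReal_eq hδ hcore hstat hF₂ hout₂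
  have hIe : Integrable (fun μ => rootEnergy lennardJones μ) P := integrable_rootEnergy_of_ae_hardCore hδ hcore
  have hD₁ : Integrable (fun μ => (∫⁻ y, F₁ (μ.map fun z => z - y) (-y) ∂μ).toReal - (∫⁻ y, F₁ μ y ∂μ).toReal) P :=
    hIi₁.sub hIo₁
  have hD₂ : Integrable (fun μ => (∫⁻ y, F₂ (μ.map fun z => z - y) (-y) ∂μ).toReal - (∫⁻ y, F₂ μ y ∂μ).toReal) P :=
    hIi₂.sub hIo₂
  have hI₁ : Integrable (fun μ => rootEnergy lennardJones μ +
      ((∫⁻ y, F₁ (μ.map fun z => z - y) (-y) ∂μ).toReal - (∫⁻ y, F₁ μ y ∂μ).toReal)) P := hIe.add hD₁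
  have hI : Integrable (fun μ => rootEnergy lennardJones μ +
      ((∫⁻ y, F₁ (μ.map fun z => z - y) (-y) ∂μ).toReal - (∫⁻ y, F₁ μ y ∂μ).toReal) -
      ((∫⁻ y, F₂ (μ.map fun z => z - y) (-y) ∂μ).toReal - (∫⁻ y, F₂ μ y ∂μ).toReal)) P := hI₁.sub hD₂
  have heq : ∫ μ, rootEnergy lennardJones μ +
      ((∫⁻ y, F₁ (μ.map fun z => z - y) (-y) ∂μ).toReal - (∫⁻ y, F₁ μ y ∂μ).toReal) -
      ((∫⁻ y, F₂ (μ.map fun z => z - y) (-y) ∂μ).toReal - (∫⁻ y, F₂ μ y ∂μ).toReal) ∂P =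
      ∫ μ, rootEnergy lennardJones μ ∂P := by
    rw [integral_sub hI₁ hD₂, integral_add hIe hD₁, integral_sub hIi₁ hIo₁, integral_sub hIi₂ hIo₂, heq₁, heq₂]
    ring
  rw [← heq]
  exact lt_integral_of_ae_lt hI hprice

end TwoTransports

/-! ## §2. The sharing transport of a measurable surrogate -/

section Sharing

/-- **Sharing a Giry-measurable quantity in a ball.**  For measurable `g : Measure ℝ³ → ℝ≥0∞` and `r > 0`, the transport «the root sends
`g ν / ν(B̄_r(0))` to each atom of its closed `r`-ball» is jointly measurable, has out-flow `g ν` on every rooted `7/10`-hard-core `ν`, and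
in-flow `∫⁻_{B̄_r(0)} g(θ_y ν) / (θ_y ν)(B̄_r(0)) dν(y)` on every `ν`. [folklore] -/
theorem sharing_transport {g : Measure E3 → ℝ≥0∞} (hg : Measurable g) {r : ℝ} (hr : 0 < r) :
    ∃ F : Measure E3 → E3 → ℝ≥0∞, Measurable (Function.uncurry F) ∧
      (∀ ν : Measure E3, IsRootedHardCore (7 / 10) ν → ∫⁻ y, F ν y ∂ν = g ν) ∧
      (∀ ν : Measure E3, ∫⁻ y, F (ν.map fun z : E3 => z - y) (-y) ∂ν =
        ∫⁻ y in closedBall (0 : E3) r, g (ν.map fun z : E3 => z - y) / (ν.map fun z : E3 => z - y) (closedBall (0 : E3) r) ∂ν) := by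
  classical
  have h7 : (0 : ℝ) < 7 / 10 := by norm_num
  set Φ : Measure E3 → ℝ≥0∞ := fun ν => g ν / ν (closedBall (0 : E3) r) with hΦ
  refine ⟨fun ν w => (closedBall (0 : E3) r).indicator (fun _ => (1 : ℝ≥0∞)) w * Φ ν, ?_, ?_, ?_⟩
  · have hΦm : Measurable Φ := by
      simp only [hΦ, div_eq_mul_inv]
      exact hg.mul (Measure.measurable_coe measurableSet_closedBall).inv
    exact ((measurable_const.indicator measurableSet_closedBall).comp measurable_snd).mul (hΦm.comp measurable_fst)
  · intro ν hν
    obtain ⟨S, h0S, hsep, hνS⟩ := id hν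
    have hne : ν (closedBall (0 : E3) r) ≠ 0 := by
      rw [hνS, Measure.restrict_apply measurableSet_closedBall]
      exact Measure.count_ne_zero ⟨0, mem_closedBall_self hr.le, h0S⟩
    have hfin : ν (closedBall (0 : E3) r) ≠ ∞ := by
      rw [hνS, Measure.restrict_apply measurableSet_closedBall,
        Measure.count_apply_finite _ (finite_inter_of_separated h7 hsep (isCompact_closedBall (0 : E3) r))]
      exact ENNReal.natCast_ne_top _
    calc ∫⁻ y, (closedBall (0 : E3) r).indicator (fun _ => (1 : ℝ≥0∞)) y * Φ ν ∂ν
        = (∫⁻ y, (closedBall (0 : E3) r).indicator (fun _ => (1 : ℝ≥0∞)) y ∂ν) * Φ ν :=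
          lintegral_mul_const _ (measurable_const.indicator measurableSet_closedBall)
      _ = ν (closedBall (0 : E3) r) * Φ ν := by rw [lintegral_indicator_const measurableSet_closedBall, one_mul]
      _ = g ν := by simp only [hΦ]; exact ENNReal.mul_div_cancel hne hfin
  · intro ν
    have hfun : (fun y : E3 => (closedBall (0 : E3) r).indicator (fun _ => (1 : ℝ≥0∞)) (-y) * Φ (ν.map fun z : E3 => z - y)) =
        (closedBall (0 : E3) r).indicator fun y => Φ (ν.map fun z : E3 => z - y) := by
      funext y
      by_cases hy : y ∈ closedBall (0 : E3) r
      · have hy' : -y ∈ closedBall (0 : E3) r := by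
          rw [mem_closedBall, dist_zero_right] at hy ⊢
          rwa [norm_neg]
        rw [indicator_of_mem hy', indicator_of_mem hy, one_mul]
      · have hy' : -y ∉ closedBall (0 : E3) r := by
          rw [mem_closedBall, dist_zero_right] at hy ⊢
          rwa [norm_neg]
        rw [indicator_of_notMem hy', indicator_of_notMem hy, zero_mul]
    rw [hfun, lintegral_indicator measurableSet_closedBall]

/-- **The Giry-measurable surrogate of `rootEnergy V_LJ − e`**, through positive and negative parts: measurable in the configuration
and equal to `rootEnergy V_LJ ν − e` on every rooted `7/10`-hard-core `ν`. [folklore] -/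
theorem exists_measurable_rootEnergy_surrogate (e : ℝ) :
    ∃ H : Measure E3 → ℝ, Measurable H ∧ ∀ ν : Measure E3, IsRootedHardCore (7 / 10) ν → H ν = rootEnergy lennardJones ν - e := by
  obtain ⟨hpm, hmm⟩ := measurable_ofReal_lennardJones_parts
  refine ⟨fun ν => ((∫⁻ z, ENNReal.ofReal (lennardJones ‖z‖) ∂ν).toReal -
      (∫⁻ z, ENNReal.ofReal (-lennardJones ‖z‖) ∂ν).toReal) / 2 - e, ?_, fun ν hν => ?_⟩
  · exact (((Measure.measurable_lintegral hpm).ennreal_toReal.sub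
      (Measure.measurable_lintegral hmm).ennreal_toReal).div_const 2).sub_const e
  · rw [(rootEnergy_eq_parts (by norm_num : (0 : ℝ) < 7 / 10) hν).2.2]

end Sharing

/-! ## §3. The surplus-sharing door -/

section Door

/-- **SURPLUS-SHARING DOOR for the crux** (route decl, by name): if for every hard core `δ > 0` and texture radii `R₇ R₈ R₉` there is a
radius `r > 0` at which every admissible rooted configuration (δ- and 7/10-hard-core, texture-charged, Nash at every atom, infinite, not a
periodic translate) has POSITIVE `#B̄_r`-weighted local surplus `Σ_{atoms y ∈ B̄_r(0)} (rootEnergy(θ_y μ) − e⋆)/μ(B̄_r(y))` (negative part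
`<` positive part), then `AperiodicFrustratedLawGap` holds. [folklore] -/
theorem aperiodicFrustratedLawGap_of_surplusSharingPrice
    (h : ∀ δ : ℝ, 0 < δ → ∀ R₇ R₈ R₉ : ℝ, let Gy : ℝ → (N : ℕ) → (Fin N → EuclideanSpace ℝ (Fin 3)) → Fin N → Prop := fun η N y j => let d : ℝ := sInf ((fun z => dist z (y (j : Fin N))) '' (Set.range (y) \ {(y (j : Fin N))})); let T : Set (EuclideanSpace ℝ (Fin 3)) := {z : EuclideanSpace ℝ (Fin 3) | z ∈ Set.range (y) ∧ z ≠ (y (j : Fin N)) ∧ dist z (y (j : Fin N)) < 13 / 10 * d}; ∃ A : EuclideanSpace ℝ (Fin 3) →ₗᵢ[ℝ] EuclideanSpace ℝ (Fin 3), (∃ e : ↥T ≃ ↥Literature.Geometry.DiscreteGeometry.fccKissingPattern, ∀ t : ↥T, dist (d⁻¹ • ((t : EuclideanSpace ℝ (Fin 3)) - (y (j : Fin N)))) (A ((e t : ↥Literature.Geometry.DiscreteGeometry.fccKissingPattern) : EuclideanSpace ℝ (Fin 3))) ≤ η) ∨ (∃ e : ↥T ≃ ↥Literature.Geometry.DiscreteGeometry.hcpKissingPattern,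 ∀ t : ↥T, dist (d⁻¹ • ((t : EuclideanSpace ℝ (Fin 3)) - (y (j : Fin N)))) (A ((e t : ↥Literature.Geometry.DiscreteGeometry.hcpKissingPattern) : EuclideanSpace ℝ (Fin 3))) ≤ η); let TexBall : (N : ℕ) → (Fin N → EuclideanSpace ℝ (Fin 3)) → Fin N → ℝ → ℝ → ℝ → ℝ → Prop := fun N y i R R₇ R₈ R₉ => (∀ a b : Fin N, a ≠ b → (7 : ℝ) / 10 ≤ dist (y a) (y b)) ∧ (∀ j : Fin N, dist (y j) (y i) ≤ R → ¬ Gy (1 / 20) N (y) j) ∧ (∀ j : Fin N, dist (y j) (y i) ≤ R → ¬ ((∀ j' : Fin N, dist (y j') (y j) ≤ R₇ → ¬ Gy (1 / 20) N (y) j') ∧ (∀ z : EuclideanSpace ℝ (Fin 3), dist z (y j) ≤ R₇ → ∃ k : Fin N, dist z (y k) ≤ 1) ∧ (∀ j' : Fin N, dist (y j') (y j) ≤ R₇ → (let d : ℝ := sInf ((fun z => dist z (y j')) '' (Set.range (y) \ {(y j')})); ∀ k : Fin N, y k ≠ y j' → dist (y k) (y j') < 27 / 20 * d → 5 ≤ Nat.card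 {m : Fin N // y m ≠ y j' ∧ dist (y m) (y j') < 27 / 20 * d ∧ y m ≠ y k ∧ dist (y m) (y k) < 27 / 20 * d})))) ∧ (∀ j : Fin N, dist (y j) (y i) ≤ R → ∃ k : Fin N, dist (y k) (y j) ≤ R₈ ∧ Gy (1 / 8) N (y) k) ∧ (∀ j : Fin N, dist (y j) (y i) ≤ R → ¬ ((∀ j' : Fin N, dist (y j') (y j) ≤ R₉ → ¬ Gy (1 / 20) N (y) j') ∧ (Nat.card {j' : Fin N // dist (y j') (y j) ≤ R₉ ∧ ¬ Gy (1 / 8) N (y) j'} : ℝ) ≤ 1 / 2 * (Nat.card {j' : Fin N // dist (y j') (y j) ≤ R₉} : ℝ) ∧ (∀ j' : Fin N, dist (y j') (y j) ≤ R₉ → ¬ Gy (1 / 8) N (y) j' → ¬ (let d : ℝ := sInf ((fun z => dist z (y j')) '' (Set.range (y) \ {(y j')})); ∀ k : Fin N, y k ≠ y j' → dist (y k) (y j') < 27 / 20 * d → 5 ≤ Nat.card {m : Fin N // y m ≠ y j' ∧ dist (y m) (y j') < 27 / 20 * d ∧ y m ≠ y k ∧ dist (y m) (y k) < 27 / 20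 * d})))); let Appr : MeasureTheory.Measure (EuclideanSpace ℝ (Fin 3)) → ℝ → ℝ → ℝ → Prop := fun μ R₇ R₈ R₉ => ∀ q : EuclideanSpace ℝ (Fin 3), μ {q} ≠ 0 → ∀ R ε : ℝ, 0 < ε → ∃ (N : ℕ) (y : Fin N → EuclideanSpace ℝ (Fin 3)) (i : Fin N), TexBall N y i R R₇ R₈ R₉ ∧ (∀ p : EuclideanSpace ℝ (Fin 3), μ {p} ≠ 0 → dist p q ≤ R → ∃ k : Fin N, dist (y k - y i) (p - q) ≤ ε) ∧ (∀ k : Fin N, dist (y k) (y i) ≤ R → ∃ p : EuclideanSpace ℝ (Fin 3), μ {p} ≠ 0 ∧ dist (y k - y i) (p - q) ≤ ε); ∃ r : ℝ, 0 < r ∧ (∀ μ : MeasureTheory.Measure (EuclideanSpace ℝ (Fin 3)), Literature.Probability.Process.IsRootedHardCore δ μ → Literature.Probability.Process.IsRootedHardCore (7 / 10) μ → Appr μ R₇ R₈ R₉ → (∀ p : EuclideanSpace ℝ (Fin 3), μ {p} ≠ 0 → ∀ y : EuclideanSpace ℝ (Fin 3), (∀ q : EuclideanSpace ℝ (Fin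 3), μ {q} ≠ 0 → q ≠ p → y ≠ q) → ∑' q : {q : EuclideanSpace ℝ (Fin 3) // μ {q} ≠ 0 ∧ q ≠ p}, Literature.MathematicalPhysics.StatisticalMechanics.lennardJones (dist p (q : EuclideanSpace ℝ (Fin 3))) ≤ ∑' q : {q : EuclideanSpace ℝ (Fin 3) // μ {q} ≠ 0 ∧ q ≠ p}, Literature.MathematicalPhysics.StatisticalMechanics.lennardJones (dist y (q : EuclideanSpace ℝ (Fin 3)))) → {p : EuclideanSpace ℝ (Fin 3) | μ {p} ≠ 0}.Infinite → ¬ (∃ Q : Literature.MathematicalPhysics.StatisticalMechanics.PeriodicConfiguration 3, ∃ t : EuclideanSpace ℝ (Fin 3), {p : EuclideanSpace ℝ (Fin 3) | μ {p} ≠ 0} = (fun s => s + t) '' Q.points) → (∫⁻ y in Metric.closedBall (0 : EuclideanSpace ℝ (Fin 3)) r, ENNReal.ofReal ((⨅ Q : Literature.MathematicalPhysics.StatisticalMechanics.PeriodicConfiguration 3, Q.energyPerParticle Literature.MathematicalPhysics.StatisticalMechanics.lennardJones) - Literature.MathematicalPhysics.StatisticalMechanics.rootEnergy Literature.MathematicalPhysics.StatisticalMechanics.lennardJones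 (MeasureTheory.Measure.map (fun z : EuclideanSpace ℝ (Fin 3) => z - y) μ)) / (MeasureTheory.Measure.map (fun z : EuclideanSpace ℝ (Fin 3) => z - y) μ) (Metric.closedBall (0 : EuclideanSpace ℝ (Fin 3)) r) ∂μ).toReal < (∫⁻ y in Metric.closedBall (0 : EuclideanSpace ℝ (Fin 3)) r, ENNReal.ofReal (Literature.MathematicalPhysics.StatisticalMechanics.rootEnergy Literature.MathematicalPhysics.StatisticalMechanics.lennardJones (MeasureTheory.Measure.map (fun z : EuclideanSpace ℝ (Fin 3) => z - y) μ) - (⨅ Q : Literature.MathematicalPhysics.StatisticalMechanics.PeriodicConfiguration 3, Q.energyPerParticle Literature.MathematicalPhysics.StatisticalMechanics.lennardJones)) / (MeasureTheory.Measure.map (fun z : EuclideanSpace ℝ (Fin 3) => z - y) μ) (Metric.closedBall (0 : EuclideanSpace ℝ (Fin 3)) r) ∂μ).toReal)) :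
    Summit.AtomisticToContinuum.Crystallization.Theses.FrustratedLawDichotomy.AperiodicFrustratedLawGap := by
  intro δ hδ P
  have h' := h δ hδ
  dsimp only at h' ⊢
  intro hP ha hb hd he h0
  obtain ⟨R₇, R₈, R₉, hd'⟩ := hd
  obtain ⟨r, hr, hprice⟩ := h' R₇ R₈ R₉
  -- the Giry-measurable surrogates of (rootEnergy − e⋆)^±
  obtain ⟨H, hHm, hH⟩ := exists_measurable_rootEnergy_surrogate
    (⨅ Q : PeriodicConfiguration 3, Q.energyPerParticle lennardJones)
  obtain ⟨F₁, hF₁, hout₁, hin₁⟩ := sharing_transport (ENNReal.measurable_ofReal.comp hHm) hr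
  obtain ⟨F₂, hF₂, hout₂, hin₂⟩ := sharing_transport (ENNReal.measurable_ofReal.comp hHm.neg) hr
  by_contra hlt
  have hmin := not_lt.mp hlt
  have h7 : ∀ᵐ μ ∂P, Literature.Probability.Process.IsRootedHardCore (7 / 10) μ := by
    refine ae_isRootedHardCore_upgrade ha (hd'.mono fun μ hμ q hq R ε hε => ?_)
    obtain ⟨N, y, i, ⟨h1, -, -, -, -⟩, hm1, -⟩ := hμ q hq R ε hε
    exact ⟨N, y, i, h1, hm1⟩
  have hinf : ∀ᵐ μ ∂P, {p : EuclideanSpace ℝ (Fin 3) | μ {p} ≠ 0}.Infinite :=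
    ae_infinite_of_minimising_of_decl Summit.AtomisticToContinuum.Crystallization.Theorems.unimodularEnergyLowerBound_proof
      hδ ha hb hmin
  have hnp : ∀ᵐ μ ∂P, ¬ (∃ Q : Literature.MathematicalPhysics.StatisticalMechanics.PeriodicConfiguration 3, ∃ t : EuclideanSpace ℝ (Fin 3), {p : EuclideanSpace ℝ (Fin 3) | μ {p} ≠ 0} = (fun s => s + t) '' Q.points) := by
    have := measure_eq_zero_iff_ae_notMem.mp h0
    filter_upwards [this] with μ hμ
    simpa only [Set.mem_setOf_eq] using hμ
  -- out-flows are bounded: |rootEnergy| is bounded on 7/10-hard-core configurations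
  have hO₁ : (∫⁻ μ, ∫⁻ y, F₁ μ y ∂μ ∂P) ≠ ⊤ := by
    refine lintegral_outflow_ne_top_of_bound (C := ENNReal.ofReal (250 / 24 * (10 / 7) ^ 12 -
      (⨅ Q : PeriodicConfiguration 3, Q.energyPerParticle lennardJones))) ENNReal.ofReal_ne_top ?_
    filter_upwards [h7] with μ hμ7
    rw [hout₁ μ hμ7, Function.comp_apply, hH μ hμ7]
    exact ENNReal.ofReal_le_ofReal (by linarith [rootEnergy_le_C0 hμ7])
  have hO₂ : (∫⁻ μ, ∫⁻ y, F₂ μ y ∂μ ∂P) ≠ ⊤ := by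
    refine lintegral_outflow_ne_top_of_bound (C := ENNReal.ofReal ((⨅ Q : PeriodicConfiguration 3, Q.energyPerParticle lennardJones) +
      250 / 12 * (10 / 7) ^ 6)) ENNReal.ofReal_ne_top ?_
    filter_upwards [h7] with μ hμ7
    rw [hout₂ μ hμ7, Function.comp_apply, Pi.neg_apply, hH μ hμ7]
    exact ENNReal.ofReal_le_ofReal (by linarith [rootEnergy_add_c0_nonneg hμ7])
  refine hlt (lt_integral_rootEnergy_of_two_transports (by norm_num : (0 : ℝ) < 7 / 10) h7 hb hF₁ hF₂ hO₁ hO₂ ?_)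
  filter_upwards [ha, h7, hd', he, hinf, hnp] with μ haμ h7μ hdμ heμ hiμ hnμ
  have hp := hprice μ haμ h7μ hdμ heμ hiμ hnμ
  -- in-flows: rewrite through the surrogate on the atoms of the ball (re-rooted configurations are hard-core)
  obtain ⟨S, h0S, hsep, hμS⟩ := id h7μ
  have hS : ∀ᵐ y ∂μ, y ∈ S := by
    rw [hμS]; exact ae_mem_of_sep (by norm_num : (0 : ℝ) < 7 / 10) hsep
  have hθ : ∀ y ∈ S, IsRootedHardCore (7 / 10) (μ.map fun z : E3 => z - y) := fun y hy =>
    h7μ.map_sub (by rw [hμS]; exact (count_restrict_singleton_ne_zero_iff S y).mpr hy)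
  have hI₁ : ∫⁻ y, F₁ (μ.map fun z : E3 => z - y) (-y) ∂μ =
      ∫⁻ y in closedBall (0 : E3) r, ENNReal.ofReal (rootEnergy lennardJones (μ.map fun z : E3 => z - y) -
        (⨅ Q : PeriodicConfiguration 3, Q.energyPerParticle lennardJones)) / (μ.map fun z : E3 => z - y) (closedBall (0 : E3) r) ∂μ := by
    rw [hin₁ μ]
    refine lintegral_congr_ae ?_
    filter_upwards [ae_restrict_of_ae hS] with y hy
    rw [Function.comp_apply, hH _ (hθ y hy)]
  have hI₂ : ∫⁻ y, F₂ (μ.map fun z : E3 => z - y) (-y) ∂μ =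
      ∫⁻ y in closedBall (0 : E3) r, ENNReal.ofReal ((⨅ Q : PeriodicConfiguration 3, Q.energyPerParticle lennardJones) -
        rootEnergy lennardJones (μ.map fun z : E3 => z - y)) / (μ.map fun z : E3 => z - y) (closedBall (0 : E3) r) ∂μ := by
    rw [hin₂ μ]
    refine lintegral_congr_ae ?_
    filter_upwards [ae_restrict_of_ae hS] with y hy
    rw [Function.comp_apply, Pi.neg_apply, hH _ (hθ y hy), neg_sub]
  -- out-flows: (h − e⋆)^+ and (h − e⋆)^−, whose real parts differ by h − e⋆
  have hsigned : (∫⁻ y, F₁ μ y ∂μ).toReal - (∫⁻ y, F₂ μ y ∂μ).toReal =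
      rootEnergy lennardJones μ - (⨅ Q : PeriodicConfiguration 3, Q.energyPerParticle lennardJones) := by
    rw [hout₁ μ h7μ, hout₂ μ h7μ, Function.comp_apply, Function.comp_apply, Pi.neg_apply, hH μ h7μ,
      ENNReal.toReal_ofReal', ENNReal.toReal_ofReal']
    exact max_zero_sub_max_neg_zero_eq_self _
  rw [hI₁, hI₂]
  linarith

/-- **SURPLUS-SHARING DOOR for the registered stub** `stub_aperiodicErgodicGap` (statement `S_aperiodicErgodicGap` verbatim). [folklore] -/
theorem aperiodicErgodicGap_of_surplusSharingPrice
    (h : ∀ δ : ℝ, 0 < δ → ∀ R₇ R₈ R₉ : ℝ, let Gy : ℝ → (N : ℕ) → (Fin N → EuclideanSpace ℝ (Fin 3)) → Fin N → Prop := fun η N y j => let d : ℝ := sInf ((fun z => dist z (y (j : Fin N))) '' (Set.range (y) \ {(y (j : Fin N))})); let T : Set (EuclideanSpace ℝ (Fin 3)) := {z : EuclideanSpace ℝ (Fin 3) | z ∈ Set.range (y) ∧ z ≠ (y (j : Fin N)) ∧ dist z (y (j : Fin N)) < 13 / 10 * d}; ∃ A : EuclideanSpace ℝ (Fin 3) →ₗᵢ[ℝ]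 EuclideanSpace ℝ (Fin 3), (∃ e : ↥T ≃ ↥Literature.Geometry.DiscreteGeometry.fccKissingPattern, ∀ t : ↥T, dist (d⁻¹ • ((t : EuclideanSpace ℝ (Fin 3)) - (y (j : Fin N)))) (A ((e t : ↥Literature.Geometry.DiscreteGeometry.fccKissingPattern) : EuclideanSpace ℝ (Fin 3))) ≤ η) ∨ (∃ e : ↥T ≃ ↥Literature.Geometry.DiscreteGeometry.hcpKissingPattern, ∀ t : ↥T, dist (d⁻¹ • ((t : EuclideanSpace ℝ (Fin 3)) - (y (j : Fin N)))) (A ((e t : ↥Literature.Geometry.DiscreteGeometry.hcpKissingPattern) : EuclideanSpace ℝ (Fin 3))) ≤ η); let TexBall : (N : ℕ) → (Fin N → EuclideanSpace ℝ (Fin 3)) → Fin N → ℝ → ℝ → ℝ → ℝ → Prop := fun N y i R R₇ R₈ R₉ => (∀ a b : Fin N, a ≠ b → (7 : ℝ) / 10 ≤ dist (y a) (y b)) ∧ (∀ j : Fin N, dist (y j) (y i) ≤ R → ¬ Gy (1 / 20) N (y) j) ∧ (∀ j : Fin N, dist (y j) (y i) ≤ R → ¬ ((∀ j' : Fin N,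 dist (y j') (y j) ≤ R₇ → ¬ Gy (1 / 20) N (y) j') ∧ (∀ z : EuclideanSpace ℝ (Fin 3), dist z (y j) ≤ R₇ → ∃ k : Fin N, dist z (y k) ≤ 1) ∧ (∀ j' : Fin N, dist (y j') (y j) ≤ R₇ → (let d : ℝ := sInf ((fun z => dist z (y j')) '' (Set.range (y) \ {(y j')})); ∀ k : Fin N, y k ≠ y j' → dist (y k) (y j') < 27 / 20 * d → 5 ≤ Nat.card {m : Fin N // y m ≠ y j' ∧ dist (y m) (y j') < 27 / 20 * d ∧ y m ≠ y k ∧ dist (y m) (y k) < 27 / 20 * d})))) ∧ (∀ j : Fin N, dist (y j) (y i) ≤ R → ∃ k : Fin N, dist (y k) (y j) ≤ R₈ ∧ Gy (1 / 8) N (y) k) ∧ (∀ j : Fin N, dist (y j) (y i) ≤ R → ¬ ((∀ j' : Fin N, dist (y j') (y j) ≤ R₉ → ¬ Gy (1 / 20) N (y) j') ∧ (Nat.card {j' : Fin N // dist (y j') (y j) ≤ R₉ ∧ ¬ Gy (1 / 8) N (y) j'} : ℝ) ≤ 1 / 2 * (Nat.card {j' : Fin N // dist (y j') (y j) ≤ R₉}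 : ℝ) ∧ (∀ j' : Fin N, dist (y j') (y j) ≤ R₉ → ¬ Gy (1 / 8) N (y) j' → ¬ (let d : ℝ := sInf ((fun z => dist z (y j')) '' (Set.range (y) \ {(y j')})); ∀ k : Fin N, y k ≠ y j' → dist (y k) (y j') < 27 / 20 * d → 5 ≤ Nat.card {m : Fin N // y m ≠ y j' ∧ dist (y m) (y j') < 27 / 20 * d ∧ y m ≠ y k ∧ dist (y m) (y k) < 27 / 20 * d})))); let Appr : MeasureTheory.Measure (EuclideanSpace ℝ (Fin 3)) → ℝ → ℝ → ℝ → Prop := fun μ R₇ R₈ R₉ => ∀ q : EuclideanSpace ℝ (Fin 3), μ {q} ≠ 0 → ∀ R ε : ℝ, 0 < ε → ∃ (N : ℕ) (y : Fin N → EuclideanSpace ℝ (Fin 3)) (i : Fin N), TexBall N y i R R₇ R₈ R₉ ∧ (∀ p : EuclideanSpace ℝ (Fin 3), μ {p} ≠ 0 → dist p q ≤ R → ∃ k : Fin N, dist (y k - y i) (p - q) ≤ ε) ∧ (∀ k : Fin N, dist (y k) (y i) ≤ R → ∃ p : EuclideanSpace ℝ (Fin 3), μ {p} ≠ 0 ∧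 dist (y k - y i) (p - q) ≤ ε); ∃ r : ℝ, 0 < r ∧ (∀ μ : MeasureTheory.Measure (EuclideanSpace ℝ (Fin 3)), Literature.Probability.Process.IsRootedHardCore δ μ → Literature.Probability.Process.IsRootedHardCore (7 / 10) μ → Appr μ R₇ R₈ R₉ → (∀ p : EuclideanSpace ℝ (Fin 3), μ {p} ≠ 0 → ∀ y : EuclideanSpace ℝ (Fin 3), (∀ q : EuclideanSpace ℝ (Fin 3), μ {q} ≠ 0 → q ≠ p → y ≠ q) → ∑' q : {q : EuclideanSpace ℝ (Fin 3) // μ {q} ≠ 0 ∧ q ≠ p}, Literature.MathematicalPhysics.StatisticalMechanics.lennardJones (dist p (q : EuclideanSpace ℝ (Fin 3))) ≤ ∑' q : {q : EuclideanSpace ℝ (Fin 3) // μ {q} ≠ 0 ∧ q ≠ p}, Literature.MathematicalPhysics.StatisticalMechanics.lennardJones (dist y (q : EuclideanSpace ℝ (Fin 3)))) → {p : EuclideanSpace ℝ (Fin 3) | μ {p} ≠ 0}.Infinite → ¬ (∃ Q : Literature.MathematicalPhysics.StatisticalMechanics.PeriodicConfiguration 3, ∃ t : EuclideanSpace ℝ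 (Fin 3), {p : EuclideanSpace ℝ (Fin 3) | μ {p} ≠ 0} = (fun s => s + t) '' Q.points) → (∫⁻ y in Metric.closedBall (0 : EuclideanSpace ℝ (Fin 3)) r, ENNReal.ofReal ((⨅ Q : Literature.MathematicalPhysics.StatisticalMechanics.PeriodicConfiguration 3, Q.energyPerParticle Literature.MathematicalPhysics.StatisticalMechanics.lennardJones) - Literature.MathematicalPhysics.StatisticalMechanics.rootEnergy Literature.MathematicalPhysics.StatisticalMechanics.lennardJones (MeasureTheory.Measure.map (fun z : EuclideanSpace ℝ (Fin 3) => z - y) μ)) / (MeasureTheory.Measure.map (fun z : EuclideanSpace ℝ (Fin 3) => z - y) μ) (Metric.closedBall (0 : EuclideanSpace ℝ (Fin 3)) r) ∂μ).toReal < (∫⁻ y in Metric.closedBall (0 : EuclideanSpace ℝ (Fin 3)) r, ENNReal.ofReal (Literature.MathematicalPhysics.StatisticalMechanics.rootEnergy Literature.MathematicalPhysics.StatisticalMechanics.lennardJones (MeasureTheory.Measure.map (fun z : EuclideanSpace ℝ (Fin 3) => z - y) μ) - (⨅ Q : Literature.MathematicalPhysics.StatisticalMechanics.PeriodicConfiguration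 3, Q.energyPerParticle Literature.MathematicalPhysics.StatisticalMechanics.lennardJones)) / (MeasureTheory.Measure.map (fun z : EuclideanSpace ℝ (Fin 3) => z - y) μ) (Metric.closedBall (0 : EuclideanSpace ℝ (Fin 3)) r) ∂μ).toReal)) :
    ∀ δ : ℝ, 0 < δ → ∀ P : MeasureTheory.Measure (MeasureTheory.Measure (EuclideanSpace ℝ (Fin 3))), let Gy : ℝ → (N : ℕ) → (Fin N → EuclideanSpace ℝ (Fin 3)) → Fin N → Prop := fun η N y j => let d : ℝ := sInf ((fun z => dist z (y (j : Fin N))) '' (Set.range (y) \ {(y (j : Fin N))})); let T : Set (EuclideanSpace ℝ (Fin 3)) := {z : EuclideanSpace ℝ (Fin 3) | z ∈ Set.range (y) ∧ z ≠ (y (j : Fin N)) ∧ dist z (y (j : Fin N)) < 13 / 10 * d}; ∃ A : EuclideanSpace ℝ (Fin 3) →ₗᵢ[ℝ] EuclideanSpace ℝ (Fin 3), (∃ e : ↥T ≃ ↥Literature.Geometry.DiscreteGeometry.fccKissingPattern, ∀ t : ↥T, dist (d⁻¹ • ((t : EuclideanSpace ℝ (Fin 3)) - (y (j : Fin N))))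 (A ((e t : ↥Literature.Geometry.DiscreteGeometry.fccKissingPattern) : EuclideanSpace ℝ (Fin 3))) ≤ η) ∨ (∃ e : ↥T ≃ ↥Literature.Geometry.DiscreteGeometry.hcpKissingPattern, ∀ t : ↥T, dist (d⁻¹ • ((t : EuclideanSpace ℝ (Fin 3)) - (y (j : Fin N)))) (A ((e t : ↥Literature.Geometry.DiscreteGeometry.hcpKissingPattern) : EuclideanSpace ℝ (Fin 3))) ≤ η); let TexBall : (N : ℕ) → (Fin N → EuclideanSpace ℝ (Fin 3)) → Fin N → ℝ → ℝ → ℝ → ℝ → Prop := fun N y i R R₇ R₈ R₉ => (∀ a b : Fin N, a ≠ b → (7 : ℝ) / 10 ≤ dist (y a) (y b)) ∧ (∀ j : Fin N, dist (y j) (y i) ≤ R → ¬ Gy (1 / 20) N (y) j) ∧ (∀ j : Fin N, dist (y j) (y i) ≤ R → ¬ ((∀ j' : Fin N, dist (y j') (y j) ≤ R₇ → ¬ Gy (1 / 20) N (y) j') ∧ (∀ z : EuclideanSpace ℝ (Fin 3), dist z (y j) ≤ R₇ → ∃ k : Fin N, dist z (y k) ≤ 1) ∧ (∀ j' : Fin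 N, dist (y j') (y j) ≤ R₇ → (let d : ℝ := sInf ((fun z => dist z (y j')) '' (Set.range (y) \ {(y j')})); ∀ k : Fin N, y k ≠ y j' → dist (y k) (y j') < 27 / 20 * d → 5 ≤ Nat.card {m : Fin N // y m ≠ y j' ∧ dist (y m) (y j') < 27 / 20 * d ∧ y m ≠ y k ∧ dist (y m) (y k) < 27 / 20 * d})))) ∧ (∀ j : Fin N, dist (y j) (y i) ≤ R → ∃ k : Fin N, dist (y k) (y j) ≤ R₈ ∧ Gy (1 / 8) N (y) k) ∧ (∀ j : Fin N, dist (y j) (y i) ≤ R → ¬ ((∀ j' : Fin N, dist (y j') (y j) ≤ R₉ → ¬ Gy (1 / 20) N (y) j') ∧ (Nat.card {j' : Fin N // dist (y j') (y j) ≤ R₉ ∧ ¬ Gy (1 / 8) N (y) j'} : ℝ) ≤ 1 / 2 * (Nat.card {j' : Fin N // dist (y j') (y j) ≤ R₉} : ℝ) ∧ (∀ j' : Fin N, dist (y j') (y j) ≤ R₉ → ¬ Gy (1 / 8) N (y) j' → ¬ (let d : ℝ := sInf ((fun z => dist z (y j')) '' (Set.range (y) \ {(y j')})); ∀ k : Fin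 N, y k ≠ y j' → dist (y k) (y j') < 27 / 20 * d → 5 ≤ Nat.card {m : Fin N // y m ≠ y j' ∧ dist (y m) (y j') < 27 / 20 * d ∧ y m ≠ y k ∧ dist (y m) (y k) < 27 / 20 * d})))); let Appr : MeasureTheory.Measure (EuclideanSpace ℝ (Fin 3)) → ℝ → ℝ → ℝ → Prop := fun μ R₇ R₈ R₉ => ∀ q : EuclideanSpace ℝ (Fin 3), μ {q} ≠ 0 → ∀ R ε : ℝ, 0 < ε → ∃ (N : ℕ) (y : Fin N → EuclideanSpace ℝ (Fin 3)) (i : Fin N), TexBall N y i R R₇ R₈ R₉ ∧ (∀ p : EuclideanSpace ℝ (Fin 3), μ {p} ≠ 0 → dist p q ≤ R → ∃ k : Fin N, dist (y k - y i) (p - q) ≤ ε) ∧ (∀ k : Fin N, dist (y k) (y i) ≤ R → ∃ p : EuclideanSpace ℝ (Fin 3), μ {p} ≠ 0 ∧ dist (y k - y i) (p - q) ≤ ε); MeasureTheory.IsProbabilityMeasure P → (∀ᵐ μ ∂P, Literature.Probability.Process.IsRootedHardCore δ μ) → Literature.Probability.Process.IsPointStationaryLaw P → (∃ R₇ R₈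 R₉ : ℝ, ∀ᵐ μ ∂P, Appr μ R₇ R₈ R₉) → (∀ᵐ μ ∂P, ∀ p : EuclideanSpace ℝ (Fin 3), μ {p} ≠ 0 → ∀ y : EuclideanSpace ℝ (Fin 3), (∀ q : EuclideanSpace ℝ (Fin 3), μ {q} ≠ 0 → q ≠ p → y ≠ q) → ∑' q : {q : EuclideanSpace ℝ (Fin 3) // μ {q} ≠ 0 ∧ q ≠ p}, Literature.MathematicalPhysics.StatisticalMechanics.lennardJones (dist p (q : EuclideanSpace ℝ (Fin 3))) ≤ ∑' q : {q : EuclideanSpace ℝ (Fin 3) // μ {q} ≠ 0 ∧ q ≠ p}, Literature.MathematicalPhysics.StatisticalMechanics.lennardJones (dist y (q : EuclideanSpace ℝ (Fin 3)))) → P {μ : MeasureTheory.Measure (EuclideanSpace ℝ (Fin 3)) | ∃ Q : Literature.MathematicalPhysics.StatisticalMechanics.PeriodicConfiguration 3, ∃ t : EuclideanSpace ℝ (Fin 3), {p : EuclideanSpace ℝ (Fin 3) | μ {p} ≠ 0} = (fun s => s + t) '' Q.points} = 0 → (∀ A : Set (MeasureTheory.Measure (EuclideanSpace ℝ (Fin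 3))), MeasurableSet A → (∀ μ : MeasureTheory.Measure (EuclideanSpace ℝ (Fin 3)), ∀ p : EuclideanSpace ℝ (Fin 3), μ {p} ≠ 0 → (μ ∈ A ↔ MeasureTheory.Measure.map (fun z : EuclideanSpace ℝ (Fin 3) => z - p) μ ∈ A)) → P A = 0 ∨ P Aᶜ = 0) → (⨅ Q : Literature.MathematicalPhysics.StatisticalMechanics.PeriodicConfiguration 3, Q.energyPerParticle Literature.MathematicalPhysics.StatisticalMechanics.lennardJones) < (∫ μ, Literature.MathematicalPhysics.StatisticalMechanics.rootEnergy Literature.MathematicalPhysics.StatisticalMechanics.lennardJones μ ∂P) := by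
  have hc := aperiodicFrustratedLawGap_of_surplusSharingPrice h
  intro δ hδ P
  have h' := hc δ hδ P
  dsimp only at h' ⊢
  intro hP ha hb hd he h0 _
  exact h' hP ha hb hd he h0

/-- **SURPLUS-SHARING DOOR for the `PeriodicChargeSplit` copy** of the shared crux decl. [folklore] -/
theorem periodicChargeSplit_aperiodicFrustratedLawGap_of_surplusSharingPrice
    (h : ∀ δ : ℝ, 0 < δ → ∀ R₇ R₈ R₉ : ℝ, let Gy : ℝ → (N : ℕ) → (Fin N → EuclideanSpace ℝ (Fin 3)) → Fin N → Prop := fun η N y j => let d : ℝ := sInf ((fun z => dist z (y (j : Fin N))) '' (Set.range (y) \ {(y (j : Fin N))})); let T : Set (EuclideanSpace ℝ (Fin 3)) := {z : EuclideanSpace ℝ (Fin 3) | z ∈ Set.range (y) ∧ z ≠ (y (j : Fin N)) ∧ dist z (y (j : Fin N)) < 13 / 10 * d}; ∃ A : EuclideanSpace ℝ (Fin 3) →ₗᵢ[ℝ] EuclideanSpace ℝ (Fin 3), (∃ e : ↥T ≃ ↥Literature.Geometry.DiscreteGeometry.fccKissingPattern, ∀ t : ↥T, dist (d⁻¹ •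 ((t : EuclideanSpace ℝ (Fin 3)) - (y (j : Fin N)))) (A ((e t : ↥Literature.Geometry.DiscreteGeometry.fccKissingPattern) : EuclideanSpace ℝ (Fin 3))) ≤ η) ∨ (∃ e : ↥T ≃ ↥Literature.Geometry.DiscreteGeometry.hcpKissingPattern, ∀ t : ↥T, dist (d⁻¹ • ((t : EuclideanSpace ℝ (Fin 3)) - (y (j : Fin N)))) (A ((e t : ↥Literature.Geometry.DiscreteGeometry.hcpKissingPattern) : EuclideanSpace ℝ (Fin 3))) ≤ η); let TexBall : (N : ℕ) → (Fin N → EuclideanSpace ℝ (Fin 3)) → Fin N → ℝ → ℝ → ℝ → ℝ → Prop := fun N y i R R₇ R₈ R₉ => (∀ a b : Fin N, a ≠ b → (7 : ℝ) / 10 ≤ dist (y a) (y b)) ∧ (∀ j : Fin N, dist (y j) (y i) ≤ R → ¬ Gy (1 / 20) N (y) j) ∧ (∀ j : Fin N, dist (y j) (y i) ≤ R → ¬ ((∀ j' : Fin N, dist (y j') (y j) ≤ R₇ → ¬ Gy (1 / 20) N (y) j') ∧ (∀ z : EuclideanSpace ℝ (Fin 3), dist z (y j) ≤ R₇ → ∃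 k : Fin N, dist z (y k) ≤ 1) ∧ (∀ j' : Fin N, dist (y j') (y j) ≤ R₇ → (let d : ℝ := sInf ((fun z => dist z (y j')) '' (Set.range (y) \ {(y j')})); ∀ k : Fin N, y k ≠ y j' → dist (y k) (y j') < 27 / 20 * d → 5 ≤ Nat.card {m : Fin N // y m ≠ y j' ∧ dist (y m) (y j') < 27 / 20 * d ∧ y m ≠ y k ∧ dist (y m) (y k) < 27 / 20 * d})))) ∧ (∀ j : Fin N, dist (y j) (y i) ≤ R → ∃ k : Fin N, dist (y k) (y j) ≤ R₈ ∧ Gy (1 / 8) N (y) k) ∧ (∀ j : Fin N, dist (y j) (y i) ≤ R → ¬ ((∀ j' : Fin N, dist (y j') (y j) ≤ R₉ → ¬ Gy (1 / 20) N (y) j') ∧ (Nat.card {j' : Fin N // dist (y j') (y j) ≤ R₉ ∧ ¬ Gy (1 / 8) N (y) j'} : ℝ) ≤ 1 / 2 * (Nat.card {j' : Fin N // dist (y j') (y j) ≤ R₉} : ℝ) ∧ (∀ j' : Fin N, dist (y j') (y j) ≤ R₉ → ¬ Gy (1 / 8) N (y) j' → ¬ (let d : ℝ := sInf ((fun z =>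 dist z (y j')) '' (Set.range (y) \ {(y j')})); ∀ k : Fin N, y k ≠ y j' → dist (y k) (y j') < 27 / 20 * d → 5 ≤ Nat.card {m : Fin N // y m ≠ y j' ∧ dist (y m) (y j') < 27 / 20 * d ∧ y m ≠ y k ∧ dist (y m) (y k) < 27 / 20 * d})))); let Appr : MeasureTheory.Measure (EuclideanSpace ℝ (Fin 3)) → ℝ → ℝ → ℝ → Prop := fun μ R₇ R₈ R₉ => ∀ q : EuclideanSpace ℝ (Fin 3), μ {q} ≠ 0 → ∀ R ε : ℝ, 0 < ε → ∃ (N : ℕ) (y : Fin N → EuclideanSpace ℝ (Fin 3)) (i : Fin N), TexBall N y i R R₇ R₈ R₉ ∧ (∀ p : EuclideanSpace ℝ (Fin 3), μ {p} ≠ 0 → dist p q ≤ R → ∃ k : Fin N, dist (y k - y i) (p - q) ≤ ε) ∧ (∀ k : Fin N, dist (y k) (y i) ≤ R → ∃ p : EuclideanSpace ℝ (Fin 3), μ {p} ≠ 0 ∧ dist (y k - y i) (p - q) ≤ ε); ∃ r : ℝ, 0 < r ∧ (∀ μ : MeasureTheory.Measure (EuclideanSpace ℝ (Fin 3)), Literature.Probability.Process.IsRootedHardCore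 δ μ → Literature.Probability.Process.IsRootedHardCore (7 / 10) μ → Appr μ R₇ R₈ R₉ → (∀ p : EuclideanSpace ℝ (Fin 3), μ {p} ≠ 0 → ∀ y : EuclideanSpace ℝ (Fin 3), (∀ q : EuclideanSpace ℝ (Fin 3), μ {q} ≠ 0 → q ≠ p → y ≠ q) → ∑' q : {q : EuclideanSpace ℝ (Fin 3) // μ {q} ≠ 0 ∧ q ≠ p}, Literature.MathematicalPhysics.StatisticalMechanics.lennardJones (dist p (q : EuclideanSpace ℝ (Fin 3))) ≤ ∑' q : {q : EuclideanSpace ℝ (Fin 3) // μ {q} ≠ 0 ∧ q ≠ p}, Literature.MathematicalPhysics.StatisticalMechanics.lennardJones (dist y (q : EuclideanSpace ℝ (Fin 3)))) → {p : EuclideanSpace ℝ (Fin 3) | μ {p} ≠ 0}.Infinite → ¬ (∃ Q : Literature.MathematicalPhysics.StatisticalMechanics.PeriodicConfiguration 3, ∃ t : EuclideanSpace ℝ (Fin 3), {p : EuclideanSpace ℝ (Fin 3) | μ {p} ≠ 0} = (fun s => s + t) '' Q.points) → (∫⁻ y in Metric.closedBall (0 : EuclideanSpace ℝ (Fin 3))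 r, ENNReal.ofReal ((⨅ Q : Literature.MathematicalPhysics.StatisticalMechanics.PeriodicConfiguration 3, Q.energyPerParticle Literature.MathematicalPhysics.StatisticalMechanics.lennardJones) - Literature.MathematicalPhysics.StatisticalMechanics.rootEnergy Literature.MathematicalPhysics.StatisticalMechanics.lennardJones (MeasureTheory.Measure.map (fun z : EuclideanSpace ℝ (Fin 3) => z - y) μ)) / (MeasureTheory.Measure.map (fun z : EuclideanSpace ℝ (Fin 3) => z - y) μ) (Metric.closedBall (0 : EuclideanSpace ℝ (Fin 3)) r) ∂μ).toReal < (∫⁻ y in Metric.closedBall (0 : EuclideanSpace ℝ (Fin 3)) r, ENNReal.ofReal (Literature.MathematicalPhysics.StatisticalMechanics.rootEnergy Literature.MathematicalPhysics.StatisticalMechanics.lennardJones (MeasureTheory.Measure.map (fun z : EuclideanSpace ℝ (Fin 3) => z - y) μ) - (⨅ Q : Literature.MathematicalPhysics.StatisticalMechanics.PeriodicConfiguration 3, Q.energyPerParticle Literature.MathematicalPhysics.StatisticalMechanics.lennardJones)) / (MeasureTheory.Measure.map (fun z : EuclideanSpace ℝ (Fin 3) => z - y) μ) (Metric.closedBall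 (0 : EuclideanSpace ℝ (Fin 3)) r) ∂μ).toReal)) :
    Summit.AtomisticToContinuum.Crystallization.Theses.PeriodicChargeSplit.AperiodicFrustratedLawGap :=
  periodicChargeSplit_aperiodicFrustratedLawGap_iff_ergodicCase.mpr (aperiodicErgodicGap_of_surplusSharingPrice h)

end Door

end Summit.AtomisticToContinuum.Crystallization.Theorems.FrustratedLawDichotomyTransportPriceSurplus

end
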